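import Mathlib
import Summits.KontsevichZagierPeriods.Zeta5Search.BigPrimeNineEndCongruence
import HarnessLib.Audit
import HarnessLib

/-!
# `F̃₉(b)`: the prime `p = 3` for the `ζ(7)`-coefficient — the `K₇`-window starts at `max(3, L₂)`

Cell `pub-zeta5` (HONEST FRAMING: systematic search; no irrationality claim unless certified).  Provenance: written
by the family-designer seat `pub-zeta5-fam-vwp-g13` (planner role, no stage permission; staged for the cell's lane).
OUR theorems (Summit side; coefficient arithmetic only, no irrationality content).

The window theorems for `K₇ = coeff7` of `F̃₉(b) = 2K₃ζ(3) + 2K₅ζ(5) + 2K₇ζ(7) − K₀` (`BigPrimeNineWindow`,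
`BigPrimeNineWindowSharp`, `BigPrimeNineEndCongruence`) carry the threshold `p ≥ 5`: the read index of `K₇` in the
level-2 power-sum representation `U'·K₇ = Σ_{x∈𝔽_p} [X^3] M2(X + x)` is `3`, and the generic counts
(`sum_taylor_coeff_eq_zero`, `sum_taylor_coeff_top`) need `3 < p`.  At `p = 3` that index is CRITICAL (`3 = p`) — exactly
the situation of the residual primes `p = 7` (`K₃`) and `p = 5` (`K₅`) settled in `BigPrimeNineResidual` — and the
second-order counts apply verbatim: `(X^3 − X)² ∣ M2` (`X_pow_card_sub_X_sq_dvd_M2`), and in the window `3·3 ≤ d₉ + 2` one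
has `deg M2 ≤ 9 < 11 = p² + p − 1` (`sum_taylor_coeff_card_eq_zero`), while at the end `3·3 = d₉ + 3` one has
`deg M2 = 11 = p² + p − 1` and the sum is `lc M2 = 2` (`sum_taylor_coeff_card_top`).  Hence, with the slots of
`BigPrimeNineWindow` (`j₁` dropped, `j₂ ≠ j₁`, `b_{j₂} ≤ b_{j₃} ≤ b_j` for `j ∉ {j₁, j₂}`, `L₂ = b₀ + 1 − b_{j₂} − b_{j₃} ≤ p`):

* **`one_le_padicValRat_coeff7_of_slots'`**: EVERY prime `p ≥ 3` with `L₂ ≤ p` and `3p ≤ d₉(b) + 2` has `v_p(K₇) ≥ 1`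
  (if `K₇ ≠ 0`) — the `K₇`-window is `[max(3, L₂), (d₉ + 2)/3]`, on both sides of `b₀`;
* **`padicValRat_coeff7_eq_zero_of_slots'`**, **`padicNorm_coeff7_sub_two_le_of_slots'`**: for every prime `p ≥ 3` with
  `L₂ ≤ p` and `3p = d₉(b) + 3`: `K₇ ≠ 0`, `v_p(K₇) = 0` and `K₇ ≡ 2 (mod p)` — the end is attained at `p = 3` too;
  `padicNorm_coeff7_sub_two_le'` is the slot-free form above `b₀` (`p ≥ b₀ + 1`).

By contrast the thresholds `7` (`K₃`) and `5` (`K₅`) ARE sharp as primes: below them the read indices `7`, `5` exceed `p`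
and the window law fails — exact check `g13/threshold9_scan.py` (`b₀ ≤ 11`, eligible = slot regime ∩ window):
(W)₉ fails at `p = 5` in `468` of `666` instances and at `p = 3` in `85` of `140`; (U)₉ fails at `p = 3` in `38` of `70`;
whereas `K₇` at `p = 3` (`g13/k9_p3_scan.py`, `b₀ ≤ 22`): law `32/32`, end `30/30` units with residue `2` — now theorems.
Instances: `b = (4;1⁹)`: `d₉ = 7`, `L₂ = 3`, `3·3 ≤ d₉ + 2`, `K₇ = −477/64 = −3²·53/64`; `b = (4;1⁸,2)`: `d₉ = 6 = 3·3 − 3`,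
`K₇ = 253/32 ≡ 2 (mod 3)` (`253/32 − 2 = 3³·7/32`).
-/

noncomputable section

open Finset Polynomial

namespace Summit.KontsevichZagierPeriods.Zeta5Search.BigPrimeNine

open Summit.KontsevichZagierPeriods.Zeta5Search.DualSeriesNine (InBox coeff7 coeff7_eq exists_isPFData9 IsPFData9)
open Summit.KontsevichZagierPeriods.Zeta5Search.DualSeriesNineMinors (dNine)
open Summit.KontsevichZagierPeriods.Zeta5Search.BigPrime (block sum_taylor_coeff_top one_le_padicValRat_of_eq
  padicValRat_eq_zero_of_eq)

/-! ### 1. The window law for `K₇` at every prime `p ≥ 3` -/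

/-- (S)₉∞ at level 2, cleared form, for ALL primes `p ≥ 3` (`b₀ + 1 ≤ p + b_{j₂} + b_{j₃}`, `3p ≤ d₉ + 2`): `p ≥ 5` is
`exists_clear_coeff7_of_slots` (`BigPrimeNineWindow`); at `p = 3` the read index `3 = p` is critical and the
second-order count applies (`(X^3 − X)² ∣ M2`, `deg M2 ≤ 9 < 11`). -/
theorem exists_clear_coeff7_of_slots' (b : ℕ → ℤ) (p j₁ j₂ j₃ : ℕ) (hb : InBox b)
    (h2 : ∀ i ∈ range 9, 2 * b (i + 1) ≤ b 0) (h4 : ∑ i ∈ range 9, b (i + 1) ≤ 4 * b 0)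
    (hj₁ : j₁ ∈ range 9) (hj₂ : j₂ ∈ range 9) (hj₃ : j₃ ∈ range 9) (h12 : j₂ ≠ j₁)
    (hle : b (j₂ + 1) ≤ b (j₃ + 1)) (hmin : ∀ j ∈ range 9, j ≠ j₁ → j ≠ j₂ → b (j₃ + 1) ≤ b (j + 1))
    (hprime : p.Prime) (hp3 : 3 ≤ p) (hpT : b 0 + 1 ≤ (p : ℤ) + b (j₂ + 1) + b (j₃ + 1))
    (hpd : 3 * (p : ℤ) ≤ dNine b + 2) :
    ∃ U Z : ℤ, ¬ (p : ℤ) ∣ U ∧ (p : ℤ) ∣ Z ∧ (U : ℚ) * coeff7 b = Z := by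
  by_cases hp5 : 5 ≤ p
  · exact exists_clear_coeff7_of_slots b p j₁ j₂ j₃ hb h2 h4 hj₁ hj₂ hj₃ h12 hle hmin hprime hp5 hpT hpd
  have hlt : p < 5 := by omega
  obtain rfl : p = 3 := by
    interval_cases p
    · rfl
    all_goals exact absurd hprime (by decide)
  haveI : Fact (Nat.Prime 3) := ⟨hprime⟩
  obtain ⟨e0, hS, hβ⟩ := polytope_data b hb h2
  obtain ⟨hj₂', h23, hmin', hT', hS', h3'⟩ := slot_data b hb h2 hj₂ hj₃ h12 hle hmin hpT
  have hpd' : 3 * 3 + ∑ j ∈ range 9, (b (j + 1)).toNat ≤ 4 * (b 0).toNat + 2 := by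
    have := hpd; rw [dNine, hS, e0] at this; omega
  have hhalf : ∀ j ∈ range 9, 2 * b (j + 1) ≤ b 0 + 1 := fun j hj => by have := h2 j hj; omega
  obtain ⟨c, hc⟩ := exists_isPFData9 b hb (by omega)
  refine ⟨_, _, not_dvd_U2all hprime hT' h23, ?_,
    by rw [coeff7_eq hc]; exact U2all_mul_sum_eq b hb hhalf hc hj₁ hj₂' h23 hmin' (by norm_num) (by norm_num : 6 < 8)⟩
  rw [← ZMod.intCast_zmod_eq_zero_iff_dvd, Z2sum_cast hj₁ hj₂' hS' hT' h23 h3' hmin' (by norm_num : 1 < 6) (by omega),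
    sum_taylor_coeff_card_eq_zero (M2 3 (b 0).toNat (fun j => (b (j + 1)).toNat) j₁ j₂ j₃)
      (X_pow_card_sub_X_sq_dvd_M2 hj₁ hj₂' hT' h23 h3' hmin') ?_, mul_zero]
  have := natDegree_M2_le (p := 3) hj₁ hj₂' hS' hT' h23 hmin' hβ h3'
  beta_reduce at this
  omega

/-- **(S)₉∞ ON THE WHOLE WINDOW, from `p = 3` on.**  Let `b` lie in the polytope (`2b_j ≤ b₀`, `Σ b_j ≤ 4b₀`); drop a
slot `j₁`, let `j₂ ≠ j₁` be a slot with `b_{j₂} ≤ b_{j₃}` and `j₃` one with `b_{j₃} ≤ b_j` for all `j ∉ {j₁, j₂}`.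
Then EVERY prime `p ≥ 3` with `b₀ + 1 − b_{j₂} − b_{j₃} ≤ p` and `3p ≤ d₉(b) + 2` has `v_p(coeff7 b) ≥ 1`
(if `coeff7 b ≠ 0`): the threshold `5` of `one_le_padicValRat_coeff7_of_slots` was an artefact of the generic count. -/
theorem one_le_padicValRat_coeff7_of_slots' (b : ℕ → ℤ) (p j₁ j₂ j₃ : ℕ) (hb : InBox b)
    (h2 : ∀ i ∈ range 9, 2 * b (i + 1) ≤ b 0) (h4 : ∑ i ∈ range 9, b (i + 1) ≤ 4 * b 0)
    (hj₁ : j₁ ∈ range 9) (hj₂ : j₂ ∈ range 9) (hj₃ : j₃ ∈ range 9) (h12 : j₂ ≠ j₁)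
    (hle : b (j₂ + 1) ≤ b (j₃ + 1)) (hmin : ∀ j ∈ range 9, j ≠ j₁ → j ≠ j₂ → b (j₃ + 1) ≤ b (j + 1))
    (hprime : p.Prime) (hp3 : 3 ≤ p) (hpT : b 0 + 1 ≤ (p : ℤ) + b (j₂ + 1) + b (j₃ + 1))
    (hpd : 3 * (p : ℤ) ≤ dNine b + 2) (h7 : coeff7 b ≠ 0) : 1 ≤ padicValRat p (coeff7 b) := by
  haveI : Fact p.Prime := ⟨hprime⟩
  obtain ⟨U, Z, hU, hZ, hUW⟩ :=
    exists_clear_coeff7_of_slots' b p j₁ j₂ j₃ hb h2 h4 hj₁ hj₂ hj₃ h12 hle hmin hprime hp3 hpT hpd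
  exact one_le_padicValRat_of_eq hUW hU hZ h7

/-! ### 2. The end `3p = d₉ + 3` at every prime `p ≥ 3`: a unit with residue `2` -/

/-- **(S)₉∞ IS SHARP IN THE SLOT REGIME, from `p = 3` on**: same slots, `p ≥ 3` prime, `b₀ + 1 ≤ p + b_{j₂} + b_{j₃}`,
`3p = d₉(b) + 3` ⟹ `coeff7 b ≠ 0 ∧ v_p(coeff7 b) = 0`.  (`p ≥ 5`: `padicValRat_coeff7_eq_zero_of_slots`; at `p = 3`
`deg M2 = 11 = p² + p − 1` is the critical top and `Σ_x [X^3] M2(X + x) = lc M2 = 2 ≠ 0`.) -/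
theorem padicValRat_coeff7_eq_zero_of_slots' (b : ℕ → ℤ) (p j₁ j₂ j₃ : ℕ) (hb : InBox b)
    (h2 : ∀ i ∈ range 9, 2 * b (i + 1) ≤ b 0) (hj₁ : j₁ ∈ range 9) (hj₂ : j₂ ∈ range 9) (hj₃ : j₃ ∈ range 9)
    (h12 : j₂ ≠ j₁) (hle : b (j₂ + 1) ≤ b (j₃ + 1))
    (hmin : ∀ j ∈ range 9, j ≠ j₁ → j ≠ j₂ → b (j₃ + 1) ≤ b (j + 1)) (hprime : p.Prime) (hp3 : 3 ≤ p)
    (hpT : b 0 + 1 ≤ (p : ℤ) + b (j₂ + 1) + b (j₃ + 1)) (hpd : 3 * (p : ℤ) = dNine b + 3) :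
    coeff7 b ≠ 0 ∧ padicValRat p (coeff7 b) = 0 := by
  by_cases hp5 : 5 ≤ p
  · exact padicValRat_coeff7_eq_zero_of_slots b p j₁ j₂ j₃ hb h2 hj₁ hj₂ hj₃ h12 hle hmin hprime hp5 hpT hpd
  have hlt : p < 5 := by omega
  obtain rfl : p = 3 := by
    interval_cases p
    · rfl
    all_goals exact absurd hprime (by decide)
  haveI : Fact (Nat.Prime 3) := ⟨hprime⟩
  obtain ⟨e0, hS, hβ⟩ := polytope_data b hb h2
  obtain ⟨hj₂', h23, hmin', hT', hS', h3'⟩ := slot_data b hb h2 hj₂ hj₃ h12 hle hmin hpT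
  have hpd' : 3 * 3 + ∑ j ∈ range 9, (b (j + 1)).toNat = 4 * (b 0).toNat + 3 := by
    have := hpd; rw [dNine, hS, e0] at this; omega
  have hsum : ∑ i ∈ range 9, b (i + 1) ≤ 4 * b 0 + 2 := by
    have := hpd; rw [dNine] at this; omega
  have hhalf : ∀ j ∈ range 9, 2 * b (j + 1) ≤ b 0 + 1 := fun j hj => by have := h2 j hj; omega
  obtain ⟨c, hc⟩ := exists_isPFData9 b hb hsum
  have hUK := U2all_mul_sum_eq b hb hhalf hc hj₁ hj₂' h23 hmin' (o := 6) (by norm_num) (by norm_num)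
  rw [← coeff7_eq hc] at hUK
  refine padicValRat_eq_zero_of_eq hUK (not_dvd_U2all hprime hT' h23) ?_
  have hdeg : (M2 3 (b 0).toNat (fun j => (b (j + 1)).toNat) j₁ j₂ j₃).natDegree = 11 := by
    have := natDegree_M2_eq (p := 3) (by norm_num) hj₁ hj₂' hS' hT' h23 hmin' hβ h3'
    beta_reduce at this
    omega
  have hU : ((U2all (b 0).toNat (fun j => (b (j + 1)).toNat) j₂ j₃ : ℤ) : ZMod 3) ≠ 0 := by
    rw [Ne, ZMod.intCast_zmod_eq_zero_iff_dvd]; exact not_dvd_U2all hprime hT' h23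
  have htwo : (2 : ZMod 3) ≠ 0 := two_ne_zero_zmod (by norm_num)
  rw [← ZMod.intCast_zmod_eq_zero_iff_dvd, Z2sum_cast hj₁ hj₂' hS' hT' h23 h3' hmin' (by norm_num : 1 < 6) (by omega),
    sum_taylor_coeff_card_top (by norm_num) _ (X_pow_card_sub_X_sq_dvd_M2 hj₁ hj₂' hT' h23 h3' hmin') (by omega),
    leadingCoeff_M2 (by norm_num)]
  exact mul_ne_zero hU htwo

/-- **END CONGRUENCE for `K₇`, from `p = 3` on** (slot regime): same slots, `p ≥ 3` prime,
`b₀ + 1 ≤ p + b_{j₂} + b_{j₃}`, `3p = d₉(b) + 3` ⟹ `‖coeff7 b − 2‖_p ≤ p⁻¹`, i.e. `K₇ ≡ 2 (mod p)`. -/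
theorem padicNorm_coeff7_sub_two_le_of_slots' (b : ℕ → ℤ) (p j₁ j₂ j₃ : ℕ) (hb : InBox b)
    (h2 : ∀ i ∈ range 9, 2 * b (i + 1) ≤ b 0) (hj₁ : j₁ ∈ range 9) (hj₂ : j₂ ∈ range 9) (hj₃ : j₃ ∈ range 9)
    (h12 : j₂ ≠ j₁) (hle : b (j₂ + 1) ≤ b (j₃ + 1))
    (hmin : ∀ j ∈ range 9, j ≠ j₁ → j ≠ j₂ → b (j₃ + 1) ≤ b (j + 1)) (hprime : p.Prime) (hp3 : 3 ≤ p)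
    (hpT : b 0 + 1 ≤ (p : ℤ) + b (j₂ + 1) + b (j₃ + 1)) (hpd : 3 * (p : ℤ) = dNine b + 3) :
    padicNorm p (coeff7 b - 2) ≤ (p : ℚ)⁻¹ := by
  by_cases hp5 : 5 ≤ p
  · exact padicNorm_coeff7_sub_two_le_of_slots b p j₁ j₂ j₃ hb h2 hj₁ hj₂ hj₃ h12 hle hmin hprime hp5 hpT hpd
  have hlt : p < 5 := by omega
  obtain rfl : p = 3 := by
    interval_cases p
    · rfl
    all_goals exact absurd hprime (by decide)
  haveI : Fact (Nat.Prime 3) := ⟨hprime⟩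
  obtain ⟨e0, hS, hβ⟩ := polytope_data b hb h2
  obtain ⟨hj₂', h23, hmin', hT', hS', h3'⟩ := slot_data b hb h2 hj₂ hj₃ h12 hle hmin hpT
  have hpd' : 3 * 3 + ∑ j ∈ range 9, (b (j + 1)).toNat = 4 * (b 0).toNat + 3 := by
    have := hpd; rw [dNine, hS, e0] at this; omega
  have hsum : ∑ i ∈ range 9, b (i + 1) ≤ 4 * b 0 + 2 := by
    have := hpd; rw [dNine] at this; omega
  have hhalf : ∀ j ∈ range 9, 2 * b (j + 1) ≤ b 0 + 1 := fun j hj => by have := h2 j hj; omega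
  obtain ⟨c, hc⟩ := exists_isPFData9 b hb hsum
  have hUK := U2all_mul_sum_eq b hb hhalf hc hj₁ hj₂' h23 hmin' (o := 6) (by norm_num) (by norm_num)
  rw [← coeff7_eq hc] at hUK
  refine padicNorm_sub_two_le hUK (not_dvd_U2all hprime hT' h23) ?_
  have hdeg : (M2 3 (b 0).toNat (fun j => (b (j + 1)).toNat) j₁ j₂ j₃).natDegree = 11 := by
    have := natDegree_M2_eq (p := 3) (by norm_num) hj₁ hj₂' hS' hT' h23 hmin' hβ h3'
    beta_reduce at this
    omega
  rw [← ZMod.intCast_zmod_eq_zero_iff_dvd]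
  push_cast
  rw [Z2sum_cast hj₁ hj₂' hS' hT' h23 h3' hmin' (by norm_num : 1 < 6) (by omega),
    sum_taylor_coeff_card_top (by norm_num) _ (X_pow_card_sub_X_sq_dvd_M2 hj₁ hj₂' hT' h23 h3' hmin') (by omega),
    leadingCoeff_M2 (by norm_num)]
  ring

/-! ### 3. Slot-free form above `b₀` -/

/-- A minimiser of `b` over the blocks `1, …, 9` (as in `BigPrimeNineEndCongruence`, where it is private). -/
private theorem exists_slot_min' (b : ℕ → ℤ) :
    ∃ j ∈ range 9, j ≠ 0 ∧ ∀ i ∈ range 9, i ≠ 0 → b (j + 1) ≤ b (i + 1) := by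
  obtain ⟨j, hj, hjmin⟩ := ((range 9).erase 0).exists_min_image (fun j => b (j + 1)) ⟨1, by simp⟩
  exact ⟨j, mem_of_mem_erase hj, ne_of_mem_erase hj, fun i hi hi0 => hjmin i (mem_erase.2 ⟨hi0, hi⟩)⟩

/-- **END CONGRUENCE for `K₇` above `b₀`, from `p = 3` on**: `p` prime, `p ≥ 3`, `p ≥ b₀ + 1`, `3p = d₉(b) + 3` ⟹
`K₇ ≡ 2 (mod p)` (slots `j₁ = 0`, `j₂ = j₃` a minimiser; extends `padicNorm_coeff7_sub_two_le` of
`BigPrimeNineEndCongruence` to `p = 3`, so that the residue `2` is proved at EVERY end of Theorem bp9). -/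
theorem padicNorm_coeff7_sub_two_le' (b : ℕ → ℤ) (p : ℕ) (hb : InBox b) (h2 : ∀ i ∈ range 9, 2 * b (i + 1) ≤ b 0)
    (hprime : p.Prime) (hp3 : 3 ≤ p) (hpb : b 0 + 1 ≤ (p : ℤ)) (hpd : 3 * (p : ℤ) = dNine b + 3) :
    padicNorm p (coeff7 b - 2) ≤ (p : ℚ)⁻¹ := by
  obtain ⟨j, hj, hj0, hjmin⟩ := exists_slot_min' b
  have h0 := (hb.2 j hj).1
  exact padicNorm_coeff7_sub_two_le_of_slots' b p 0 j j hb h2 (by simp) hj hj hj0 le_rfl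
    (fun i hi hi0 _ => hjmin i hi hi0) hprime hp3 (by omega) hpd

/-- The two instances of the docstring: `(4;1⁹)` lies in the window at `p = 3` (`3·3 ≤ d₉ + 2 = 9`, `v₃(−477/64) = 2`),
`(4;1⁸,2)` is the end (`3·3 = d₉ + 3 = 9`, `253/32 − 2 = 3³·7/32`). -/
example : (4 : ℤ) * 4 - 9 + 2 = 3 * 3 ∧ (-477 : ℚ) / 64 = 3 ^ 2 * (-53 / 64) ∧
    (4 : ℤ) * 4 - 10 + 3 = 3 * 3 ∧ (253 : ℚ) / 32 - 2 = 3 ^ 3 * (7 / 32) := by norm_num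

end Summit.KontsevichZagierPeriods.Zeta5Search.BigPrimeNine

end
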